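import Literature.NumberTheory.GaloisRepresentations.PresentationOfFiniteGaloisModule
import Literature.NumberTheory.GaloisRepresentations.HomPermutationModuleVanishing
import Literature.Algebra.Homology.DiscreteRepFreePresentation
import Literature.Algebra.Homology.DiscreteRepGaloisCorollaries
import HarnessLib

/-!
# Objects of `C_{Γ_K}` as discrete Galois modules (native currency), and the canonical free
# presentation `0 → N₁ → ℤ[Γ_K/U_{K(M)}]^{|M|} → M → 0` as a short exact sequence of discrete Galois modules

Topic `NumberTheory/GaloisRepresentations`; namespaces `Literature.NumberTheory.GaloisRepresentations.DGMBridge` (§1–§2,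
any field `K`) and `Literature.NumberTheory.GaloisRepresentations.FreePresentation` (§3–§4).  Definitions with bodies and theorems;
no named fact, no `sorry`; instances ONLY on the new type synonym `LCarrier` (the carrier of an object of `C_Γ`
with the discrete topology), exactly as `HomCarrier` in `DiscreteRepExtInternalHomGalois`.

THE POINT (the "`C_Γ ↔ DGM` bridge" of the presentation road to Milne ADT I Lemma 4.13 / Thm. 4.10, crux
`stmt-BirchSwinnertonDyer-19295`, cell `bsd-schneider-ideate`).  Door-c4's presentation `FreePresentation.presentationComplex ρ`
of a finite discrete Galois module lives in the abelian category `C_Γ = DiscreteRepCat ℤ Γ_K` (where `Ext`, the boundary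
`∂` and the chase live), while the local readout (`HomDual.dualδ₀`, `dualδ₀_units_restrict_surjective`,
`exists_unitValued_of_unramified`, `(R2)`) is written for the tree's NATIVE `DiscreteGaloisModule`s and `IsSES`.
Serre (GC I §2.1): for the DISCRETE topology the two notions are the same thing.  Here:

* §1 `LCarrier X` — the carrier `X.obj.V` of `X : DiscreteRepCat ℤ Γ_K` with the discrete topology (and the
  additive structure of `X.obj`); `lrep X` its `Γ_K`-action (on additive maps, so that only the canonical
  `ℤ`-module structure is used); **`toDGM X : DiscreteGaloisModule K (LCarrier X)`**; `moduleFinite_lcarrier`.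
* §2 **`lmap u`** — a `C_Γ`-morphism `u : X ⟶ Y` as a continuous equivariant map `toDGM X →ⁱL toDGM Y`, and
  **`lmapTo ρ u`** for `u : X ⟶ ofDiscreteGaloisModule ρ` with target the GIVEN module `ρ` (not its synonym);
  `exact_apply` (elementwise exactness in `C_Γ`), **`isSES_of_shortExact`**: a short exact `S` in `C_Γ` with
  `S.X₃ = ofDiscreteGaloisModule ρ` is an `IsSES` of discrete Galois modules `toDGM S.X₁ → toDGM S.X₂ → ρ`.
* §3 the presentation of `ρ`: `presModule₁ ρ`, `presModule₂ ρ` (= `toDGM` of `N₁`, `P`), `presIncl ρ`, `presProj ρ`,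
  **`pres_isSES ρ`**, `moduleFinite_presModule₁/₂`.
* §4 the permutation structure of `P = ℤ[Γ/U]^{|M|}` in native currency: the `Γ_K`-set `Fin |M| × Γ/U_{K(M)}`
  (`presIndexAction`, a `def` installed with `letI`), `presModuleBasis`, **`permutedBasis_presModule₂`**,
  **`uniformIsotropy_presIndex`** (`K(M)` normal), `smul_presIndex_eq_of_apply_eq_one` — the hypotheses of
  `HomDual.dualδ₀_units_restrict_surjective` / `HomDual.galUnr_le_stabilizer_of_isUnramifiedAt` for this presentation.

HONEST FRAMING: bookkeeping only; no case of Poitou–Tate or BSD is proved here.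

## References
* J.-P. Serre, *Galois Cohomology* (1997), I §2.1 (discrete modules), I §2.2. [SerreGaloisCohomology1997]
* J. S. Milne, *Arithmetic Duality Theorems* (2nd ed. 2006), I Lemma 1.9 (proof), I Lemma 4.13 (proof). [MilneADT2006]
* K. S. Brown, *Cohomology of Groups* (1982), III §5. [Brown1982CohomologyGroups]
-/

noncomputable section

open CategoryTheory CategoryTheory.Limits
open Field (absoluteGaloisGroup)
open scoped ContRepresentation

/-! ## §1 Objects of `C_{Γ_K}` as discrete Galois modules -/

namespace Literature.NumberTheory.GaloisRepresentations

namespace DGMBridge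

open Literature.Algebra.Homology Literature.Algebra.Homology.DiscreteRep

variable {K : Type} [Field K]

-- On the vectors `X.obj.V` of an object of `Rep ℤ Γ` two `Module ℤ` structures compete (`Rep.hV2` and
-- `AddCommGroup.toIntModule`); as in door-c4's `DiscreteRepFreePresentation` the representation's own structure is
-- preferred on `X.obj.V`.  The synonym `LCarrier X` only ever carries the canonical structure of its `AddCommGroup`.
attribute [local instance 10000] Rep.hV2

/-- **The carrier of an object of `C_{Γ_K}`, to be given the DISCRETE topology** (a type synonym of `X.obj.V`).
[cite: SerreGaloisCohomology1997, I §2.1] -/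
def LCarrier (X : DiscreteRepCat ℤ (absoluteGaloisGroup K)) : Type := X.obj.V

variable (X Y Z : DiscreteRepCat ℤ (absoluteGaloisGroup K))

/-- The additive structure of `X.obj.V`. [cite: SerreGaloisCohomology1997, I §2.1] -/
instance LCarrier.instAddCommGroup : AddCommGroup (LCarrier X) := inferInstanceAs (AddCommGroup X.obj.V)

/-- The discrete topology. [cite: SerreGaloisCohomology1997, I §2.1] -/
instance LCarrier.instTopologicalSpace : TopologicalSpace (LCarrier X) := ⊥

/-- The topology on `LCarrier X` is discrete by definition. [cite: SerreGaloisCohomology1997, I §2.1] -/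
instance LCarrier.instDiscreteTopology : DiscreteTopology (LCarrier X) := ⟨rfl⟩

/-- The identification `X.obj.V → LCarrier X` (the identity). [cite: SerreGaloisCohomology1997, I §2.1] -/
def LCarrier.of : X.obj.V →+ LCarrier X := AddMonoidHom.id _

/-- The identification `LCarrier X → X.obj.V` (the identity). [cite: SerreGaloisCohomology1997, I §2.1] -/
def LCarrier.val : LCarrier X →+ X.obj.V := AddMonoidHom.id _

/-- `val (of x) = x`. [cite: SerreGaloisCohomology1997, I §2.1] -/
@[simp] theorem LCarrier.val_of (x : X.obj.V) : LCarrier.val X (LCarrier.of X x) = x := rfl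

/-- **The `Γ_K`-action on `LCarrier X`** (the action of `X.obj`, through additive maps, so that the canonical
`ℤ`-module structure of the synonym is the one in play). [cite: SerreGaloisCohomology1997, I §2.1] -/
def lrep : Representation ℤ (absoluteGaloisGroup K) (LCarrier X) where
  toFun σ := ((LCarrier.of X).comp ((X.obj.ρ σ).toAddMonoidHom.comp (LCarrier.val X))).toIntLinearMap
  map_one' := LinearMap.ext fun x => by
    change LCarrier.of X (X.obj.ρ 1 (LCarrier.val X x)) = x
    rw [map_one]
    rfl
  map_mul' σ τ := LinearMap.ext fun x => by
    change LCarrier.of X (X.obj.ρ (σ * τ) (LCarrier.val X x)) =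
      LCarrier.of X (X.obj.ρ σ (LCarrier.val X (LCarrier.of X (X.obj.ρ τ (LCarrier.val X x)))))
    rw [map_mul]
    rfl

/-- The stabilisers of `lrep X` are those of `X.obj`, hence open. [cite: SerreGaloisCohomology1997, I §2.1] -/
theorem isOpen_setOf_lrep_apply_eq (x : LCarrier X) : IsOpen {σ : absoluteGaloisGroup K | lrep X σ x = x} :=
  X.property (LCarrier.val X x)

/-- **`X : C_{Γ_K}` as a discrete Galois module on `LCarrier X`.** [cite: SerreGaloisCohomology1997, I §2.1] -/
def toDGM : DiscreteGaloisModule K (LCarrier X) :=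
  DiscreteGaloisModule.ofIsOpenStabilizer (lrep X) (isOpen_setOf_lrep_apply_eq X)

/-- Unfolding: `toDGM X σ x = X.obj.ρ σ x`. [cite: SerreGaloisCohomology1997, I §2.1] -/
@[simp] theorem toDGM_apply (σ : absoluteGaloisGroup K) (x : LCarrier X) :
    toDGM X σ x = LCarrier.of X (X.obj.ρ σ (LCarrier.val X x)) := rfl

/-- `Module.Finite ℤ` for ANY `ℤ`-module structure gives it for the canonical one (they all coincide).
[cite: MilneADT2006, I Lemma 1.9 (proof)] -/
theorem moduleFinite_toIntModule {V : Type} [AddCommGroup V] (i : Module ℤ V) (h : @Module.Finite ℤ V _ _ i) :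
    @Module.Finite ℤ V _ _ (AddCommGroup.toIntModule V) := by
  obtain rfl : i = AddCommGroup.toIntModule V := Subsingleton.elim _ _
  exact h

/-- `LCarrier X` is `ℤ`-finite as soon as `X.obj.V` is (for the representation's own `ℤ`-module structure).
[cite: MilneADT2006, I Lemma 1.9 (proof)] -/
theorem moduleFinite_lcarrier (h : Module.Finite ℤ X.obj.V) : Module.Finite ℤ (LCarrier X) :=
  moduleFinite_toIntModule (V := LCarrier X) X.obj.hV2 h

/-! ## §2 Morphisms and short exact sequences -/

/-- The underlying additive map of a `C_Γ`-morphism on the synonyms. [cite: SerreGaloisCohomology1997, I §2.2] -/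
def lmapAddHom (u : X ⟶ Y) : LCarrier X →+ LCarrier Y :=
  (LCarrier.of Y).comp (u.hom.hom.toLinearMap.toAddMonoidHom.comp (LCarrier.val X))

/-- Unfolding. [cite: SerreGaloisCohomology1997, I §2.2] -/
@[simp] theorem lmapAddHom_apply (u : X ⟶ Y) (x : LCarrier X) :
    lmapAddHom X Y u x = LCarrier.of Y (u.hom.hom (LCarrier.val X x)) := rfl

/-- Equivariance of `lmapAddHom`. [cite: SerreGaloisCohomology1997, I §2.2] -/
theorem lmapAddHom_smul (u : X ⟶ Y) (σ : absoluteGaloisGroup K) (x : LCarrier X) :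
    lmapAddHom X Y u (toDGM X σ x) = toDGM Y σ (lmapAddHom X Y u x) := by
  rw [toDGM_apply, toDGM_apply, lmapAddHom_apply, lmapAddHom_apply, LCarrier.val_of, LCarrier.val_of]
  exact congrArg (LCarrier.of Y) (Rep.hom_comm_apply u.hom σ (LCarrier.val X x))

/-- **A `C_Γ`-morphism `u : X ⟶ Y` as a continuous equivariant map `toDGM X →ⁱL toDGM Y`.**
[cite: SerreGaloisCohomology1997, I §2.2] -/
def lmap (u : X ⟶ Y) : (toDGM X).toContRepresentation →ⁱL (toDGM Y).toContRepresentation where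
  toLinearMap := (lmapAddHom X Y u).toIntLinearMap
  cont := continuous_of_discreteTopology
  isIntertwining' σ := by
    refine ContinuousLinearMap.ext fun x => ?_
    simpa [ContinuousRep.toContRepresentation_apply_apply] using lmapAddHom_smul X Y u σ x

/-- Unfolding `lmap`. [cite: SerreGaloisCohomology1997, I §2.2] -/
@[simp] theorem lmap_apply (u : X ⟶ Y) (x : LCarrier X) :
    lmap X Y u x = LCarrier.of Y (u.hom.hom (LCarrier.val X x)) := rfl

variable {M : Type} [AddCommGroup M] [TopologicalSpace M] [DiscreteTopology M] (ρ : DiscreteGaloisModule K M)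

/-- The underlying additive map of `u : X ⟶ ofDiscreteGaloisModule ρ`, valued in the GIVEN module `M`.
[cite: SerreGaloisCohomology1997, I §2.2] -/
def lmapToAddHom (u : X ⟶ ofDiscreteGaloisModule ρ) : LCarrier X →+ M :=
  (show (ofDiscreteGaloisModule ρ).obj.V →+ M from AddMonoidHom.id M).comp
    (u.hom.hom.toLinearMap.toAddMonoidHom.comp (LCarrier.val X))

/-- Unfolding. [cite: SerreGaloisCohomology1997, I §2.2] -/
@[simp] theorem lmapToAddHom_apply (u : X ⟶ ofDiscreteGaloisModule ρ) (x : LCarrier X) :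
    lmapToAddHom X ρ u x = u.hom.hom (LCarrier.val X x) := rfl

/-- Equivariance of `lmapToAddHom` for the given `ρ`. [cite: SerreGaloisCohomology1997, I §2.2] -/
theorem lmapToAddHom_smul (u : X ⟶ ofDiscreteGaloisModule ρ) (σ : absoluteGaloisGroup K) (x : LCarrier X) :
    lmapToAddHom X ρ u (toDGM X σ x) = ρ σ (lmapToAddHom X ρ u x) := by
  rw [toDGM_apply, lmapToAddHom_apply, lmapToAddHom_apply, LCarrier.val_of]
  exact Rep.hom_comm_apply u.hom σ (LCarrier.val X x)

/-- **A `C_Γ`-morphism `u : X ⟶ ofDiscreteGaloisModule ρ` as a continuous equivariant map `toDGM X →ⁱL ρ`.**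
[cite: SerreGaloisCohomology1997, I §2.2] -/
def lmapTo (u : X ⟶ ofDiscreteGaloisModule ρ) : (toDGM X).toContRepresentation →ⁱL ρ.toContRepresentation where
  toLinearMap := (lmapToAddHom X ρ u).toIntLinearMap
  cont := continuous_of_discreteTopology
  isIntertwining' σ := by
    refine ContinuousLinearMap.ext fun x => ?_
    simpa [ContinuousRep.toContRepresentation_apply_apply] using lmapToAddHom_smul X ρ u σ x

/-- Unfolding `lmapTo`. [cite: SerreGaloisCohomology1997, I §2.2] -/
@[simp] theorem lmapTo_apply (u : X ⟶ ofDiscreteGaloisModule ρ) (x : LCarrier X) :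
    lmapTo X ρ u x = u.hom.hom (LCarrier.val X x) := rfl

/-- **Elementwise exactness in `C_Γ`**: for an exact `S`, a vector of `S.X₂` killed by `S.g` comes from `S.X₁`
(the inclusion `C_Γ ⥤ Rep ℤ Γ ⥤ Mod_ℤ` is exact and faithful). [cite: SerreGaloisCohomology1997, I §2.2] -/
theorem exact_apply {S : ShortComplex (DiscreteRepCat ℤ (absoluteGaloisGroup K))} (hS : S.Exact)
    (y : S.X₂.obj.V) (hy : S.g.hom.hom y = 0) : ∃ x : S.X₁.obj.V, S.f.hom.hom x = y := by
  haveI : (ι ℤ (absoluteGaloisGroup K)).PreservesHomology :=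
    ⟨fun _ _ f => (isDiscrete ℤ (absoluteGaloisGroup K)).preservesKernels_ι f,
      fun _ _ f => (isDiscrete ℤ (absoluteGaloisGroup K)).preservesCokernels_ι f⟩
  have h := hS
  rw [← ShortComplex.exact_map_iff_of_faithful _ (ι ℤ (absoluteGaloisGroup K)),
    ← ShortComplex.exact_map_iff_of_faithful _ (forget₂ (Rep.{0} ℤ (absoluteGaloisGroup K)) (ModuleCat.{0} ℤ)),
    ShortComplex.moduleCat_exact_iff] at h
  obtain ⟨x, hx⟩ := h y hy
  exact ⟨x, hx⟩

/-- For a short exact `S` in `C_Γ`, `S.f` is injective on vectors. [cite: SerreGaloisCohomology1997, I §2.2] -/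
theorem shortExact_f_injective {S : ShortComplex (DiscreteRepCat ℤ (absoluteGaloisGroup K))} (hS : S.ShortExact) :
    Function.Injective S.f.hom.hom :=
  (Rep.mono_iff_injective ((ι ℤ (absoluteGaloisGroup K)).map S.f)).1 (by haveI := hS.mono_f; infer_instance)

/-- For a short exact `S` in `C_Γ`, `S.g` is surjective on vectors. [cite: SerreGaloisCohomology1997, I §2.2] -/
theorem shortExact_g_surjective {S : ShortComplex (DiscreteRepCat ℤ (absoluteGaloisGroup K))} (hS : S.ShortExact) :
    Function.Surjective S.g.hom.hom :=
  (Rep.epi_iff_surjective ((ι ℤ (absoluteGaloisGroup K)).map S.g)).1 (by haveI := hS.epi_g; infer_instance)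

/-- For a complex `S` in `C_Γ`, `S.g (S.f x) = 0` on vectors. [cite: SerreGaloisCohomology1997, I §2.2] -/
theorem shortComplex_g_f_apply (S : ShortComplex (DiscreteRepCat ℤ (absoluteGaloisGroup K))) (x : S.X₁.obj.V) :
    S.g.hom.hom (S.f.hom.hom x) = 0 := by
  change (S.f ≫ S.g).hom.hom x = 0
  rw [S.zero]
  rfl

/-- **A short exact `S` in `C_Γ` whose third object is `ofDiscreteGaloisModule ρ` is a native short exact sequence
`toDGM S.X₁ → toDGM S.X₂ → ρ` of discrete Galois modules (`IsSES`).** [cite: SerreGaloisCohomology1997, I §2.1, I §2.2] -/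
theorem isSES_of_shortExact {X₁ X₂ : DiscreteRepCat ℤ (absoluteGaloisGroup K)} (f : X₁ ⟶ X₂)
    (g : X₂ ⟶ ofDiscreteGaloisModule ρ) (w : f ≫ g = 0) (hS : (ShortComplex.mk f g w).ShortExact) :
    IsSES (toTopRepHom (toDGM X₁) (toDGM X₂) (lmap X₁ X₂ f)) (toTopRepHom (toDGM X₂) ρ (lmapTo X₂ ρ g)) where
  comp_eq_zero := by
    apply TopRep.hom_ext
    rw [TopRep.hom_comp, TopRep.hom_zero]
    exact DFunLike.ext _ _ fun x => shortComplex_g_f_apply (ShortComplex.mk f g w) (LCarrier.val X₁ x)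
  injective := fun a b h => shortExact_f_injective hS h
  exact_mid := fun y hy => by
    obtain ⟨x, hx⟩ := exact_apply (S := ShortComplex.mk f g w) hS.exact (LCarrier.val X₂ y) hy
    exact ⟨LCarrier.of X₁ x, hx⟩
  surjective := fun m => by
    obtain ⟨y, hy⟩ := shortExact_g_surjective (S := ShortComplex.mk f g w) hS m
    exact ⟨LCarrier.of X₂ y, hy⟩

/-- **A short exact `S` in `C_Γ` is a native short exact sequence `toDGM S.X₁ → toDGM S.X₂ → toDGM S.X₃`.**
[cite: SerreGaloisCohomology1997, I §2.1, I §2.2] -/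
theorem isSES_toDGM {S : ShortComplex (DiscreteRepCat ℤ (absoluteGaloisGroup K))} (hS : S.ShortExact) :
    IsSES (toTopRepHom (toDGM S.X₁) (toDGM S.X₂) (lmap S.X₁ S.X₂ S.f))
      (toTopRepHom (toDGM S.X₂) (toDGM S.X₃) (lmap S.X₂ S.X₃ S.g)) where
  comp_eq_zero := by
    apply TopRep.hom_ext
    rw [TopRep.hom_comp, TopRep.hom_zero]
    exact DFunLike.ext _ _ fun x => congrArg (LCarrier.of S.X₃) (shortComplex_g_f_apply S (LCarrier.val S.X₁ x))
  injective := fun a b h => shortExact_f_injective hS h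
  exact_mid := fun y hy => by
    obtain ⟨x, hx⟩ := exact_apply (S := S) hS.exact (LCarrier.val S.X₂ y) hy
    exact ⟨LCarrier.of S.X₁ x, hx⟩
  surjective := fun m => by
    obtain ⟨y, hy⟩ := shortExact_g_surjective (S := S) hS (LCarrier.val S.X₃ m)
    exact ⟨LCarrier.of S.X₂ y, hy⟩

end DGMBridge

end Literature.NumberTheory.GaloisRepresentations


/-! ## §3 The canonical presentation of a finite discrete Galois module, natively -/

namespace Literature.NumberTheory.GaloisRepresentations

namespace FreePresentation

open Literature.Algebra.Homology Literature.Algebra.Homology.DiscreteRep HomPermutation IdeleClassBar DGMBridge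

variable {K : Type} [Field K] [NumberField K]
variable {M : Type} [AddCommGroup M] [TopologicalSpace M] [DiscreteTopology M] [Finite M]
variable (ρ : DiscreteGaloisModule K M)

/-- **`N₁`, the relation module of the presentation of `ρ`, as a discrete Galois module** (on `LCarrier`).
[cite: MilneADT2006, I Lemma 1.9 (proof), I Lemma 4.13 (proof)] -/
abbrev presModule₁ : DiscreteGaloisModule K (LCarrier (presentationComplex ρ).X₁) := toDGM (presentationComplex ρ).X₁

/-- **`P = ℤ[Γ_K/U_{K(M)}]^{|M|}`, the free module of the presentation of `ρ`, as a discrete Galois module.**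
[cite: MilneADT2006, I Lemma 1.9 (proof), I Lemma 4.13 (proof)] -/
abbrev presModule₂ : DiscreteGaloisModule K (LCarrier (presentationComplex ρ).X₂) := toDGM (presentationComplex ρ).X₂

/-- The inclusion `N₁ → P` of the presentation, natively. [cite: MilneADT2006, I Lemma 1.9 (proof)] -/
abbrev presIncl : (presModule₁ ρ).toContRepresentation →ⁱL (presModule₂ ρ).toContRepresentation :=
  lmap (presentationComplex ρ).X₁ (presentationComplex ρ).X₂ (presentationComplex ρ).f

/-- The projection `P → M` of the presentation, natively (valued in the GIVEN module `ρ`).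
[cite: MilneADT2006, I Lemma 1.9 (proof)] -/
abbrev presProj : (presModule₂ ρ).toContRepresentation →ⁱL ρ.toContRepresentation :=
  lmapTo (presentationComplex ρ).X₂ ρ (presentationComplex ρ).g

/-- **The presentation `0 → N₁ → P → M → 0` of `ρ` is a native short exact sequence of discrete Galois modules.**
[cite: MilneADT2006, I Lemma 1.9 (proof), I Lemma 4.13 (proof)] -/
theorem pres_isSES :
    IsSES (toTopRepHom (presModule₁ ρ) (presModule₂ ρ) (presIncl ρ)) (toTopRepHom (presModule₂ ρ) ρ (presProj ρ)) :=
  isSES_of_shortExact ρ (kernel.ι (presentationHom ρ)) (presentationHom ρ) (kernel.condition _)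
    (presentationComplex_shortExact ρ)

/-- `P` is `ℤ`-finite. [cite: MilneADT2006, I Lemma 1.9 (proof)] -/
theorem moduleFinite_presModule₂ : Module.Finite ℤ (LCarrier (presentationComplex ρ).X₂) :=
  moduleFinite_lcarrier _ (moduleFinite_presLattice (presentationLayer ρ) (presentationRank ρ))

/-- `N₁` is `ℤ`-finite (a subobject of `P`). [cite: MilneADT2006, I Lemma 1.9 (proof)] -/
theorem moduleFinite_presModule₁ : Module.Finite ℤ (LCarrier (presentationComplex ρ).X₁) := by
  haveI := (presentationComplex_shortExact ρ).mono_f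
  exact moduleFinite_lcarrier _
    (moduleFinite_of_mono (presentationComplex ρ).f (moduleFinite_presLattice (presentationLayer ρ) (presentationRank ρ)))

/-! ## §4 The permutation structure of `P` over `Γ_K`: permuted basis, uniform isotropy `Γ_{K(M)}` -/

/-- The index set `Fin |M| × Γ_K/U_{K(M)}` of the standard basis of `P` (a `Γ_K`-set by left translation on the
second factor, Mathlib's `Sigma`/quotient actions). [cite: Brown1982CohomologyGroups, III §5] -/
abbrev PresIndex : Type :=
  Σ _ : Fin (presentationRank ρ),
    absoluteGaloisGroup K ⧸ ((presentationLayer ρ).openNormalSubgroup : Subgroup (absoluteGaloisGroup K))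

/-- `γ • ⟨i, [τ]⟩ = ⟨i, [γ τ]⟩`. [cite: Brown1982CohomologyGroups, III §5] -/
theorem smul_presIndex_mk (γ τ : absoluteGaloisGroup K) (i : Fin (presentationRank ρ)) :
    (γ • (⟨i, QuotientGroup.mk τ⟩ : PresIndex ρ)) = ⟨i, QuotientGroup.mk (γ * τ)⟩ := rfl

/-- **The standard basis of `P`, indexed by `Fin |M| × Γ_K/U_{K(M)}`** (door-c6 g16's `presBasis`, on `LCarrier`).
[cite: MilneADT2006, I Lemma 1.9 (proof)] -/
def presModuleBasis : Module.Basis (PresIndex ρ) ℤ (LCarrier (presentationComplex ρ).X₂) :=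
  (presBasis (presentationLayer ρ) (presentationRank ρ)).map
    { toFun := LCarrier.of (presentationComplex ρ).X₂
      invFun := LCarrier.val (presentationComplex ρ).X₂
      map_add' := fun _ _ => rfl
      map_smul' := fun c x => by
        change LCarrier.of (presentationComplex ρ).X₂ (c • x) = c • LCarrier.of (presentationComplex ρ).X₂ x
        refine congrArg (fun i : Module ℤ (presLattice (presentationLayer ρ) (presentationRank ρ)).obj.V =>
          (show LCarrier (presentationComplex ρ).X₂ from @HSMul.hSMul ℤ _ _ (@instHSMul ℤ _ i.toSMul) c x)) ?_
        exact Subsingleton.elim _ _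
      left_inv := fun _ => rfl
      right_inv := fun _ => rfl }

/-- `presModuleBasis ⟨i, q⟩ = single i (single q 1)`. [cite: MilneADT2006, I Lemma 1.9 (proof)] -/
theorem presModuleBasis_apply (b : PresIndex ρ) :
    presModuleBasis ρ b =
      LCarrier.of (presentationComplex ρ).X₂ (presBasis (presentationLayer ρ) (presentationRank ρ) b) := by
  rw [presModuleBasis, Module.Basis.map_apply]
  rfl

/-- **The basis of `P` is permuted by `Γ_K`**: `σ · e⟨i, q⟩ = e⟨i, σ q⟩` (hypothesis `PermutedBasis` of
`HomDual.dualδ₀_units_restrict_surjective`). [cite: Brown1982CohomologyGroups, III §5 Prop. (5.8)][cite: MilneADT2006, I Lemma 4.13 (proof)] -/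
theorem permutedBasis_presModule₂ : PermutedBasis K (presModule₂ ρ) (presModuleBasis ρ) := by
  rintro γ ⟨i, q⟩
  induction q using QuotientGroup.induction_on with
  | H τ =>
    rw [smul_presIndex_mk, presModuleBasis_apply, presModuleBasis_apply, toDGM_apply, LCarrier.val_of, presBasis_apply,
      presBasis_apply]
    exact congrArg (LCarrier.of (presentationComplex ρ).X₂) (Representation.free_single_single _ _ _ _)

/-- **Uniform isotropy**: every isotropy group of `Γ_K` on `Fin |M| × Γ_K/U_{K(M)}` is `Γ_{K(M)} = U_{K(M)}`
(hypothesis `UniformIsotropy` of `HomDual.dualδ₀_units_restrict_surjective`, with the normal layer `L = K(M)`).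
[cite: Brown1982CohomologyGroups, III §5 Prop. (5.8)][cite: MilneADT2006, I Lemma 4.13 (proof)] -/
theorem uniformIsotropy_presIndex :
    haveI := (presentationLayer ρ).isGalois
    UniformIsotropy K (PresIndex ρ) (presentationLayer ρ).1 := by
  haveI := (presentationLayer ρ).isGalois
  rintro ⟨i, q⟩
  induction q using QuotientGroup.induction_on with
  | H τ =>
    ext γ
    rw [MulAction.mem_stabilizer_iff, smul_presIndex_mk, mem_absGaloisFixingSubgroup_iff]
    constructor
    · intro h
      have h' : (QuotientGroup.mk (γ * τ) : absoluteGaloisGroup K ⧸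
          ((presentationLayer ρ).openNormalSubgroup : Subgroup (absoluteGaloisGroup K))) = QuotientGroup.mk τ :=
        (Sigma.mk.inj_iff.1 h).2 |> eq_of_heq
      rw [QuotientGroup.eq] at h'
      -- `(γ τ)⁻¹ τ = τ⁻¹ γ⁻¹ τ ∈ U`, so `γ⁻¹ ∈ U`, so `γ ∈ U = Gal(K̄/K(M))`
      have hγ : γ ∈ ((presentationLayer ρ).openNormalSubgroup : Subgroup (absoluteGaloisGroup K)) := by
        have h1 : τ * ((γ * τ)⁻¹ * τ) * τ⁻¹ ∈
            ((presentationLayer ρ).openNormalSubgroup : Subgroup (absoluteGaloisGroup K)) :=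
          Subgroup.Normal.conj_mem inferInstance _ h' τ
        rw [mul_inv_rev, show τ * (τ⁻¹ * γ⁻¹ * τ) * τ⁻¹ = γ⁻¹ by group] at h1
        exact (Subgroup.inv_mem_iff _).1 h1
      exact fun x hx => (IntermediateField.mem_fixingSubgroup_iff _ _).1 hγ x hx
    · intro h
      have hγ : γ ∈ ((presentationLayer ρ).openNormalSubgroup : Subgroup (absoluteGaloisGroup K)) :=
        (IntermediateField.mem_fixingSubgroup_iff _ _).2 h
      have h' : (QuotientGroup.mk (γ * τ) : absoluteGaloisGroup K ⧸
          ((presentationLayer ρ).openNormalSubgroup : Subgroup (absoluteGaloisGroup K))) = QuotientGroup.mk τ := by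
        rw [QuotientGroup.eq, mul_inv_rev]
        have h1 : τ⁻¹ * γ⁻¹ * τ⁻¹⁻¹ ∈ ((presentationLayer ρ).openNormalSubgroup : Subgroup (absoluteGaloisGroup K)) :=
          Subgroup.Normal.conj_mem inferInstance _ ((Subgroup.inv_mem_iff _).2 hγ) τ⁻¹
        simpa only [inv_inv, mul_assoc] using h1
      rw [h']

/-- **`ker ρ` fixes the index set** (hypothesis `hβ` of the inertia bridge `HomDual.galUnr_le_stabilizer_of_isUnramifiedAt`).
[cite: MilneADT2006, I Lemma 1.9 (proof)] -/
theorem smul_presIndex_eq_of_apply_eq_one (γ : absoluteGaloisGroup K) (b : PresIndex ρ) (hγ : ρ γ = 1) : γ • b = b := by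
  obtain ⟨i, q⟩ := b
  rw [Sigma.smul_mk, smul_eq_of_apply_eq_one ρ hγ q]

end FreePresentation

end Literature.NumberTheory.GaloisRepresentations

end
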